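import Summits.RiemannHypothesis.RiemannHypothesis.Theorems.OddSectorOddArchAnchorSmoothFold
import Literature.NumberTheory.LFunctions.WeilExplicit
import Mathlib.Data.Real.Sign
import HarnessLib

set_option linter.dupNamespace false

/-!
# Smooth radial fold of an odd test function (origin-layer line of `OddSector.OddOneSignedWindows`)

Stub `stub_smoothFoldRadial` of the line `Sketch` of crux item stmt-RiemannHypothesis-17778
(RH-free real analysis, normalisation of `Literature/NumberTheory/LFunctions/WeilExplicit.lean`:
test functions `IsWeilTest g` are smooth with compact support).

For an ODD test function `g` and `η > 0` we construct an odd test function `h` with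
`tsupport h ⊆ tsupport g` which is REAL, `≥ 0` on `(0, ∞)`, and on the half-line `x > 0` is a
radial `1`-Lipschitz image of `g`: `h(x) = Ψ_η(g(x))` with `Ψ_η(z) = η L(|z|/η − 1)`,
`L(v) = v e^{-1/v}` (`v > 0`), `L = 0` on `(−∞, 0]`. Since `L` is `1`-Lipschitz,
`|h(s) − h(x)| ≤ ||g(s)| − |g(x)||` (the RADIAL Lipschitz bound: comparison with the exact fold
`|g|`) and `|h(x)| ≤ |g(x)|` for `x, s > 0`, and `h` is uniformly `2η`-close to the non-smooth
fold `sign(x) |g(x)|`. This is the construction of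
`OddArchAnchor.exists_smooth_fold` (Theorems/OddSectorOddArchAnchorSmoothFold.lean) with the
stronger conclusions (realness, non-negativity on `(0, ∞)`, radial Lipschitz bound) exported.

No definitions are introduced into the tree (the auxiliary functions are local to the proof).
-/

noncomputable section

open Complex Filter Set MeasureTheory
open scoped Real Topology ComplexConjugate ENNReal

namespace Summit.RiemannHypothesis.RiemannHypothesis.Theorems.OddSector

open Literature.NumberTheory.LFunctions
open Summit.RiemannHypothesis.RiemannHypothesis.Theorems.OddArchAnchor (mul_expNegInvGlue_le
  sub_one_le_mul_expNegInvGlue lipschitzWith_mul_expNegInvGlue)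

/-- **A smooth antisymmetric radial fold.** For an odd test function `g` and `η > 0` there is an
odd, real test function `h` with `tsupport h ⊆ tsupport g`, `h ≥ 0` on `(0, ∞)`, such that, for
all `x, s > 0`, `|h(s) − h(x)| ≤ ||g(s)| − |g(x)||` and `|h(x)| ≤ |g(x)|`, and
`|h(x) − sign(x)|g(x)|| ≤ 2η` for every `x`. (On `x > 0`, `h = Ψ_η ∘ g` for a smooth radial
`Ψ_η : ℂ → [0, ∞)`, `1`-Lipschitz as a function of `|z|`, with `Ψ_η(z) = 0` for `|z| ≤ η` and
`|z| − 2η ≤ Ψ_η(z) ≤ |z|`.) -/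
theorem stub_smoothFoldRadial :
    ∀ (g : ℝ → ℂ), IsWeilTest g → (∀ x, g (-x) = -g x) → ∀ η : ℝ, 0 < η →
      ∃ h : ℝ → ℂ, IsWeilTest h ∧ (∀ x, h (-x) = -h x) ∧ tsupport h ⊆ tsupport g ∧
        (∀ x, (h x).im = 0) ∧ (∀ x, 0 < x → 0 ≤ (h x).re) ∧
        (∀ x s, 0 < x → 0 < s → ‖h s - h x‖ ≤ |‖g s‖ - ‖g x‖|) ∧
        (∀ x, 0 < x → ‖h x‖ ≤ ‖g x‖) ∧
        (∀ x, ‖h x - ((Real.sign x * ‖g x‖ : ℝ) : ℂ)‖ ≤ 2 * η) := by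
  -- adapted from Theorems/OddSectorOddArchAnchorSmoothFold.lean
  -- (`OddArchAnchor.exists_smooth_fold`: same construction, weaker exported conclusions)
  intro g hg hgo η hη
  -- the profile and the radial map
  set L : ℝ → ℝ := fun v ↦ v * expNegInvGlue v with hL
  have hLs : ContDiff ℝ ((⊤ : ℕ∞) : WithTop ℕ∞) L := contDiff_id.mul expNegInvGlue.contDiff
  have hL0 : ∀ v, v ≤ 0 → L v = 0 := fun v hv ↦ by
    simp only [hL, expNegInvGlue.zero_of_nonpos hv, mul_zero]
  have hLnn : ∀ v, 0 ≤ L v := fun v ↦ by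
    rcases le_or_gt v 0 with h | h
    · rw [hL0 v h]
    · exact mul_nonneg h.le (expNegInvGlue.nonneg v)
  have hLlip : LipschitzWith 1 L := lipschitzWith_mul_expNegInvGlue
  set Ψ : ℂ → ℝ := fun z ↦ η * L (‖z‖ / η - 1) with hΨ
  have hΨ0 : ∀ z : ℂ, ‖z‖ ≤ η → Ψ z = 0 := fun z hz ↦ by
    have : ‖z‖ / η - 1 ≤ 0 := by rw [sub_nonpos, div_le_one hη]; exact hz
    simp only [hΨ, hL0 _ this, mul_zero]
  have hΨnn : ∀ z, 0 ≤ Ψ z := fun z ↦ mul_nonneg hη.le (hLnn _)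
  have hΨle : ∀ z, Ψ z ≤ ‖z‖ := fun z ↦ by
    rcases le_or_gt (‖z‖ / η - 1) 0 with h | h
    · simp only [hΨ, hL0 _ h, mul_zero, norm_nonneg]
    · have h1 := mul_expNegInvGlue_le h.le
      have h2 : η * (‖z‖ / η - 1) = ‖z‖ - η := by field_simp
      calc Ψ z ≤ η * (‖z‖ / η - 1) := mul_le_mul_of_nonneg_left h1 hη.le
        _ = ‖z‖ - η := h2
        _ ≤ ‖z‖ := by linarith
  have hΨge : ∀ z, ‖z‖ - 2 * η ≤ Ψ z := fun z ↦ by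
    have h1 := sub_one_le_mul_expNegInvGlue (‖z‖ / η - 1)
    have h2 : η * (‖z‖ / η - 1 - 1) = ‖z‖ - 2 * η := by field_simp; ring
    calc ‖z‖ - 2 * η = η * (‖z‖ / η - 1 - 1) := h2.symm
      _ ≤ Ψ z := mul_le_mul_of_nonneg_left h1 hη.le
  -- the RADIAL Lipschitz bound: `Ψ` is `1`-Lipschitz as a function of `‖z‖`
  have hΨlip : ∀ z w : ℂ, |Ψ z - Ψ w| ≤ |‖z‖ - ‖w‖| := fun z w ↦ by
    have h1 := hLlip.dist_le_mul (‖z‖ / η - 1) (‖w‖ / η - 1)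
    rw [NNReal.coe_one, one_mul, Real.dist_eq, Real.dist_eq] at h1
    have h2 : |‖z‖ / η - 1 - (‖w‖ / η - 1)| = |‖z‖ - ‖w‖| / η := by
      rw [show ‖z‖ / η - 1 - (‖w‖ / η - 1) = (‖z‖ - ‖w‖) / η by ring, abs_div, abs_of_pos hη]
    rw [h2] at h1
    have h3 : Ψ z - Ψ w = η * (L (‖z‖ / η - 1) - L (‖w‖ / η - 1)) := by simp only [hΨ]; ring
    rw [h3, abs_mul, abs_of_pos hη]
    calc η * |L (‖z‖ / η - 1) - L (‖w‖ / η - 1)| ≤ η * (|‖z‖ - ‖w‖| / η) :=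
          mul_le_mul_of_nonneg_left h1 hη.le
      _ = |‖z‖ - ‖w‖| := by field_simp
  have hΨneg : ∀ z, Ψ (-z) = Ψ z := fun z ↦ by simp only [hΨ, norm_neg]
  have hΨs : ContDiff ℝ ((⊤ : ℕ∞) : WithTop ℕ∞) Ψ := by
    rw [contDiff_iff_contDiffAt]
    intro z
    by_cases hz : z = 0
    · -- `Ψ` vanishes on the ball of radius `η`
      have hev : Ψ =ᶠ[𝓝 z] fun _ ↦ 0 := by
        rw [hz]
        filter_upwards [Metric.ball_mem_nhds (0 : ℂ) hη] with w hw
        exact hΨ0 w (mem_ball_zero_iff.1 hw).le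
      exact (contDiffAt_const (c := (0 : ℝ))).congr_of_eventuallyEq hev
    · have h1 : ContDiffAt ℝ ((⊤ : ℕ∞) : WithTop ℕ∞) (fun w : ℂ ↦ ‖w‖ / η - 1) z :=
        ((contDiffAt_norm ℂ hz).div_const η).sub contDiffAt_const
      exact contDiffAt_const.mul (hLs.contDiffAt.comp z h1)
  -- the cutoff near the origin
  have hg0 : g 0 = 0 := by
    have h := hgo 0
    rw [neg_zero] at h
    exact CharZero.eq_neg_self_iff.1 h
  obtain ⟨δ, hδ, hδg⟩ : ∃ δ > 0, ∀ x : ℝ, |x| < δ → ‖g x‖ < η := by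
    have hc : ContinuousAt g 0 := hg.1.continuous.continuousAt
    rcases Metric.continuousAt_iff.1 hc η hη with ⟨δ, hδ, h⟩
    refine ⟨δ, hδ, fun x hx ↦ ?_⟩
    have := h (by simpa [Real.dist_eq] using hx)
    simpa [hg0, dist_eq_norm] using this
  set θ : ℝ → ℝ := fun x ↦ Real.smoothTransition (x / δ) - Real.smoothTransition (-x / δ) with hθ
  have hθs : ContDiff ℝ ((⊤ : ℕ∞) : WithTop ℕ∞) θ :=
    (Real.smoothTransition.contDiff.comp (contDiff_id.div_const δ)).sub
      (Real.smoothTransition.contDiff.comp (contDiff_neg.div_const δ))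
  have hθodd : ∀ x, θ (-x) = -θ x := fun x ↦ by
    simp only [hθ, neg_neg]
    ring
  have hθ1 : ∀ x, δ ≤ x → θ x = 1 := fun x hx ↦ by
    have h1 : 1 ≤ x / δ := by rwa [le_div_iff₀ hδ, one_mul]
    have h2 : -x / δ ≤ 0 := div_nonpos_of_nonpos_of_nonneg (by linarith) hδ.le
    simp only [hθ, Real.smoothTransition.one_of_one_le h1, Real.smoothTransition.zero_of_nonpos h2,
      sub_zero]
  -- the fold
  set h : ℝ → ℂ := fun x ↦ ((θ x * Ψ (g x) : ℝ) : ℂ) with hh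
  have hpos : ∀ x, 0 < x → h x = ((Ψ (g x) : ℝ) : ℂ) := fun x hx ↦ by
    rcases le_or_gt δ x with h1 | h1
    · simp only [hh, hθ1 x h1, one_mul]
    · have : Ψ (g x) = 0 := hΨ0 _ (hδg x (by rwa [abs_of_pos hx])).le
      simp only [hh, this, mul_zero]
  have hodd : ∀ x, h (-x) = -h x := fun x ↦ by
    simp only [hh, hθodd, hgo, hΨneg, neg_mul, Complex.ofReal_neg]
  refine ⟨h, ⟨?_, ?_⟩, hodd, ?_, ?_, ?_, ?_, ?_, ?_⟩
  · -- smoothness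
    have h1 : ContDiff ℝ ((⊤ : ℕ∞) : WithTop ℕ∞) fun x ↦ Ψ (g x) := hΨs.comp hg.1
    exact Complex.ofRealCLM.contDiff.comp (hθs.mul h1)
  · -- compact support
    refine hg.2.mono fun x hx ↦ ?_
    rw [Function.mem_support] at hx ⊢
    intro h0
    apply hx
    simp only [hh, h0, hΨ0 0 (by simp [hη.le]), mul_zero, Complex.ofReal_zero]
  · -- `tsupport h ⊆ tsupport g`
    refine closure_mono fun x hx ↦ ?_
    rw [Function.mem_support] at hx ⊢
    intro h0
    apply hx
    simp only [hh, h0, hΨ0 0 (by simp [hη.le]), mul_zero, Complex.ofReal_zero]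
  · -- realness
    intro x
    exact Complex.ofReal_im _
  · -- non-negativity on the half-line
    intro x hx
    rw [hpos x hx, Complex.ofReal_re]
    exact hΨnn _
  · -- half-line radial contraction
    intro x s hx hs
    rw [hpos x hx, hpos s hs, ← Complex.ofReal_sub, Complex.norm_real, Real.norm_eq_abs]
    exact hΨlip _ _
  · -- domination
    intro x hx
    rw [hpos x hx, Complex.norm_real, Real.norm_of_nonneg (hΨnn _)]
    exact hΨle _
  · -- uniform closeness to `sign · |g|`
    have hp : ∀ x, 0 < x → ‖h x - ((Real.sign x * ‖g x‖ : ℝ) : ℂ)‖ ≤ 2 * η := fun x hx ↦ by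
      rw [hpos x hx, Real.sign_of_pos hx, one_mul, ← Complex.ofReal_sub, Complex.norm_real,
        Real.norm_eq_abs, abs_le]
      constructor <;> linarith [hΨle (g x), hΨge (g x)]
    intro x
    rcases lt_trichotomy x 0 with hx | hx | hx
    · have hy : 0 < -x := by linarith
      have h1 := hp (-x) hy
      rw [Real.sign_of_pos hy] at h1
      have e1 : h x = -h (-x) := by rw [hodd, neg_neg]
      have e2 : ‖g x‖ = ‖g (-x)‖ := by rw [hgo, norm_neg]
      rw [Real.sign_of_neg hx, e1, e2]
      calc ‖-h (-x) - (((-1 : ℝ) * ‖g (-x)‖ : ℝ) : ℂ)‖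
          = ‖-(h (-x) - (((1 : ℝ) * ‖g (-x)‖ : ℝ) : ℂ))‖ := by congr 1; push_cast; ring
        _ = ‖h (-x) - (((1 : ℝ) * ‖g (-x)‖ : ℝ) : ℂ)‖ := norm_neg _
        _ ≤ 2 * η := h1
    · subst hx
      have h0 : h 0 = 0 := by simp only [hh, hθ, neg_zero, sub_self, zero_mul, Complex.ofReal_zero]
      rw [h0, Real.sign_zero, zero_mul, Complex.ofReal_zero, sub_zero, norm_zero]
      positivity
    · exact hp x hx

end Summit.RiemannHypothesis.RiemannHypothesis.Theorems.OddSector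

end
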